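import Summits.QuantumFields.YangMills.Theorems.BalabanUVNodesN15FullPropagatorV1XAllLayersN15At
import Summits.QuantumFields.YangMills.Theorems.BalabanUVNodesN15SiteAveragingSpecies
import Summits.QuantumFields.YangMills.Theorems.BalabanUVNodesN15SiteScalarLayerDressedSizedF
import HarnessLib

/-!
# Route «BalabanUVNodes», cluster K4 «SpineRates» — node N15 = NE2: THE SITE LAYER WITH THE BACKGROUND LIVE IN THE TwoGrid ENTRY CURRENCY, XIX — PART XV's `Live` ALL-LAYERS
# FAMILY WITH THE AVERAGING PERTURBATION LIVE: FILE 40's sized gauge-dressed carriers, OPERATOR = FILE 40 `fgFamilyV1XAS`, UNIT = part XV `v1CovBgEx`, SITE = the FULL (3.65)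
# perturbation `(Q′ + F₂)(X(X − G′) + (X − G′)G′)(Q′* + F₂*)`-words of THE massless scalar site propagator with BOTH species — first-order `V̂(φ∘A′)` (part XII) AND averaging
# `F₂(φ∘A′), F₂*(φ∘A′)` (part XVII §2) — READ OFF the gauge field; `PairedFamilyGuard.Live ∧ N15At`, no species binder left in any layer

Cell `pub-ymgap`, WIDTH SEAT `pub-ymgap-dag-n15-w1` (generation 3; director-ym №197 ∕ HUMAN RULING D-0149; chair R455 (A) ∕ R461; plan g83 `W-SEAT-START-LIST.md` v11 §n15).
`bears_on: R4∕N15 · K3⁷ SpineGivenEndpointR13SepCoPH (stmt-QuantumFields-20544)`.  Filed `--supports stmt-QuantumFields-20544 --as helper` — COUNT-NEUTRAL.  Three plumbing `def`s (the two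
(3.65) perturbation matrices with the averaging species live; the `NE2Objects₁₁` literal), the rest theorems; 0 `sorry`.  Imports BY NAME, nothing in the tree modified: this seat's part XV
`…N15FullPropagatorV1XAllLayersN15At` (`v1CovBgEx`, `ne2PlusUnit_v1CovBgEx`; through it part XII `V1IndexSM`, `v1SiteSpeciesF∕C`, `v1SiteSpecies_letters`, `live_v1XAS_site`, FILE 40
`fgInstanceV1GS`∕`fgFamilyV1XAS`, S-E `n15At_v1XAS`), part XVII `…N15SiteAveragingSpecies` (`v1AvgFc∕Fsc∕Ff∕Fsf`, `v1AvgSpecies_letters`) and part XVIII `…N15SiteScalarLayerDressedSizedF`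
(`ne2PlusSite_sSiteExOn_of_sizedSpeciesLettersF`).

WHY.  Part XV's family — the lineage's strongest re-pin candidate (all three layers read the background, size live, `Live`) — still builds its site perturbation with the PLAIN block
mean `Q′`: the averaging perturbation `F₂ = Q′(U′U) − Q′` of [Balaban1985BackgroundPropagators] (3.58) p.402 is DROPPED there.  With part XVII's concrete linearised species read at size
and part XVIII's sized bridge, THIS FILE switches it on: the site kernel is part XI's sized socket at part VI's `sitePert365F` words with BOTH species concrete, every letter a theorem
of FILE 40's `Reg335`; operator and unit layers are part XV's verbatim (same paired instances, same `Kop`, same `Kunit` — only `Ksite` changes).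

CONTENTS.  §1 defs `v1SitePertFF ∕ v1SitePertFC` (+ `_eq`); §2 ★★ `ne2PlusSite_v1XAS_siteF` (part XVIII §2 ∘ (part XII §2, part XVII §2); `K_av`'s fit read at `M_jα₀ ≤ 1`); §3 ★★★
**`n15At_v1XAllF`**, ★★★ **`live_and_n15At_v1XAllF`**; §4 the `NE2Objects₁₁` literal `v1XAllFObjects` + `live_and_n15At_v1XAllFObjects` ∕ `populated_…` ∕ `_family`, keyed face
`s_N15_of_admits_v1XAllF_family` (part XV's pattern), `v1XAllFObjects_pi_eq` (same index set ∕ instances ∕ `Kop` ∕ `Kunit` as part XV's literal); §5 POSITIVE CONTROL —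
`siteAvgKer_const_bpt_one`, `fibAvg_mulOp_single`, ★ `v1AvgFf_const_ne_zero` (at a constant gauge field `A′ ≡ a` with `φ a ≠ 0` the fine averaging species is a NON-ZERO operator: the
averaging words carry content off `A′ = 0`).

HONEST FRAMING.  Count-neutral KNIT; no new estimate.  MODEL-LEVEL in every species exactly as parts XII ∕ XV ∕ XVII say (abelian component `φ∘A′`; first-order site species on the bonds
out of a site; linearised, abelianised one-level contour kernel for the averaging perturbation; plain block mean at `U ≡ 1`; King's pairing; the unit layer's abelianised pair
`(0, φ∘A′)`); the sub-index `m ≥ 1`.  GENUINE ∕ PRINTED-SHAPE: the sized (3.35) window `c₃₅Mα₀` and smallness `Mα₀ ≤ a₀`, THE massless scalar site propagator and its site form, the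
(2.156) covariance's exact dressing, King's pairing, the guard `Live`.  NOT [B9] Thms 3.1∕3.2∕3.15 at a general (3.35)-regular non-abelian `U` (NE2⁺ NOT PRINTED as an η-rate); Node 00's
[B9] layers of record are residual — **N15 is NOT discharged** (typed 28∕28 · discharged 5∕27 of record unchanged); K3⁷ OPEN and not claimed (its v5 pins N15 to `fullGSizedObjects`; a
re-pin is the plan's act, this literal is a CANDIDATE only); one finite four-torus programme at fixed `ε` — NOT ℝ⁴, NOT infinite volume, NOT OS, NOT a mass gap, NOT Clay; R4 closes the
conditional finite-𝕋⁴ rung `BalabanLadder.UV` only.  Restate-immune (no Theses import).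
-/

set_option autoImplicit false

noncomputable section

open scoped BigOperators Matrix
open Finset

namespace Summit.QuantumFields.YangMills.BalabanUVNodes.N15.SiteLayerBg

open Literature.MathematicalPhysics.QuantumFieldTheory.Balaban1983to89
open Literature.MathematicalPhysics.QuantumFieldTheory.Balaban1983to89.T4Continuum (T4Family ULoop)
open Literature.MathematicalPhysics.QuantumFieldTheory.Balaban1983to89.B11SectG (BlockNorm HasMaj)
open Literature.MathematicalPhysics.QuantumFieldTheory.Balaban1983to89.T4EtaRate (PairedInstance EtaPairing NE2PlusOperator NE2PlusSite NE2PlusUnit)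
open Literature.MathematicalPhysics.QuantumFieldTheory.Balaban1983to89.T4EtaRateDefect (idef)
open Literature.MathematicalPhysics.QuantumFieldTheory.Balaban1983to89.T4EtaRateCoeffDefect (pull diagK diagK_mono fibre mem_fibre)
open Literature.MathematicalPhysics.QuantumFieldTheory.Balaban1983to89.B5Prop11Plancherel (Tor fine)
open Literature.MathematicalPhysics.QuantumFieldTheory.Balaban1983to89.B5Block118 (bpt)
open Literature.MathematicalPhysics.QuantumFieldTheory.Balaban1983to89.B6Prop26Gluing (mulOp mulOp_apply)
open Literature.MathematicalPhysics.QuantumFieldTheory.Balaban1983to89.B5QGGQ145Bounds (Idx)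
open Literature.MathematicalPhysics.QuantumFieldTheory.Balaban1983to89.NE2NodeTorus (ne2PlusOperator_reindex)
open Literature.MathematicalPhysics.QuantumFieldTheory.King1986.Torus (blockOf)
open Summit.QuantumFields.BalabanUV.T4Continuum.HistoryFlow (two_le_L)
open Summit.QuantumFields.YangMills.BalabanUVNodes.N15.TwoGrid (TGIndex)
open Summit.QuantumFields.YangMills.BalabanUVNodes.N15.VectorPiece (unitTorusGeoS blkFine lineSum lineSum_bpt stairSum)
open Summit.QuantumFields.YangMills.BalabanUVNodes.N15.MatrixSpecies (liftBlk)
open Summit.QuantumFields.YangMills.BalabanUVNodes.N15.BackgroundLayer (fgInstanceV1GS fgFamilyV1XAS fibAvg fibAvg_apply)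
open Summit.QuantumFields.YangMills.BalabanUVNodes.N15.SiteLayer (dressedOp)
open Summit.QuantumFields.YangMills.BalabanUVNodes.N15.GenuineRecord (TGIndexS n15At_v1XAS)
open Summit.QuantumFields.YangMills.BalabanUVNodes.N15.PairedFamilyGuard (Live)
open Summit.QuantumFields.YangMills.BalabanUVNodes.N15.AtKeyedHome (s_N15_of_admits neZero_blockFactor)
open Summit.QuantumFields.YangMills.BalabanUVNodes.N15KingModelRung.Curved (kingGOp kingDOp underPtN)
open YMDAG.UVSplit (Datum RateCarriers RateRecordPred N15At S_N15 ne2OfRecord₁₁)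

variable {d : ℕ} {L : ℕ} [NeZero L]
variable (d) (𝔄 : Type) [NormedRing 𝔄] [NormedAlgebra ℝ 𝔄] [CompleteSpace 𝔄] (ι : Type) [Fintype ι] [DecidableEq ι] [Nonempty ι] (e : 𝔄 ≃L[ℝ] (ι → ℝ)) (φ : 𝔄 →L[ℝ] ℝ)

/-! ## §1 The (3.65) site perturbation matrices of the sized family with the averaging species live -/

section Pert

/-- THE FINE RUN's FULL (3.65) SITE PERTURBATION MATRIX at `(j, ν)`: part VI's `siteEntries (sitePert365F (blockOf ∘ pr) F₂′(φ∘A′) F₂*′(φ∘A′) G′ X(A′))`, `G′` THE massless scalar site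
propagator of the fine run, `X(A′) = dressedOp G′ D V̂(φ∘A′)` (part XII's species), `F₂′, F₂*′` part XVII §2's sized averaging species. [cite: Balaban1985BackgroundPropagators, (3.58) p.402, (3.65) p.403 (shape)] -/
def v1SitePertFF (hL : Odd L ∧ 1 < L) (aS : ℝ) (j : TGIndexS × Fin (d + 1)) (A : (fgInstanceV1GS d 𝔄 ι hL j).Bf.Cfg) :
    Matrix (Idx (TGIndex.Mn d hL j.1.toTGIndex)) (Idx (TGIndex.Mn d hL j.1.toTGIndex)) ℝ :=
  siteEntries (TGIndex.Mn d hL j.1.toTGIndex) (sitePert365F (TGIndex.Mn d hL j.1.toTGIndex)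
    (blockOf (L ^ j.1.k) (TGIndex.Mn d hL j.1.toTGIndex) ∘ underPtN L j.1.k j.1.m (TGIndex.Mn d hL j.1.toTGIndex)) (v1AvgFf d 𝔄 ι φ hL j A) (v1AvgFsf d 𝔄 ι φ hL j A)
    (kingGOp L aS 0 (j.1.k + j.1.m) (L ^ j.1.m * L ^ j.1.k) (TGIndex.Mn d hL j.1.toTGIndex))
    (dressedOp (kingGOp L aS 0 (j.1.k + j.1.m) (L ^ j.1.m * L ^ j.1.k) (TGIndex.Mn d hL j.1.toTGIndex))
      (fun μ => kingDOp L aS 0 (j.1.k + j.1.m) (L ^ j.1.m * L ^ j.1.k) (TGIndex.Mn d hL j.1.toTGIndex) μ) (v1SiteSpeciesF d 𝔄 ι φ hL j A)))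

/-- THE COARSE RUN's FULL (3.65) SITE PERTURBATION MATRIX at `(j, ν)` (`G′ = kingGOp L a_S 0 k (L^k) M`). [cite: Balaban1985BackgroundPropagators, (3.58) p.402, (3.65) p.403 (shape)] -/
def v1SitePertFC (hL : Odd L ∧ 1 < L) (aS : ℝ) (j : TGIndexS × Fin (d + 1)) (B : (fgInstanceV1GS d 𝔄 ι hL j).Bc.Cfg) :
    Matrix (Idx (TGIndex.Mn d hL j.1.toTGIndex)) (Idx (TGIndex.Mn d hL j.1.toTGIndex)) ℝ :=
  siteEntries (TGIndex.Mn d hL j.1.toTGIndex) (sitePert365F (TGIndex.Mn d hL j.1.toTGIndex) (blockOf (L ^ j.1.k) (TGIndex.Mn d hL j.1.toTGIndex))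
    (v1AvgFc d 𝔄 ι φ hL j B) (v1AvgFsc d 𝔄 ι φ hL j B) (kingGOp L aS 0 j.1.k (L ^ j.1.k) (TGIndex.Mn d hL j.1.toTGIndex))
    (dressedOp (kingGOp L aS 0 j.1.k (L ^ j.1.k) (TGIndex.Mn d hL j.1.toTGIndex)) (fun μ => kingDOp L aS 0 j.1.k (L ^ j.1.k) (TGIndex.Mn d hL j.1.toTGIndex) μ)
      (v1SiteSpeciesC d 𝔄 ι φ hL j B)))

end Pert

/-! ## §2 ★★ `NE2PlusSite` on the sized family, both species live -/

section Site

omit [CompleteSpace 𝔄] [DecidableEq ι] [Nonempty ι] in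
/-- ★★ **`NE2PlusSite` WITH THE BACKGROUND LIVE AND THE AVERAGING PERTURBATION LIVE ON FILE 40's SIZED GAUGE-DRESSED FAMILY** (sub-index `m ≥ 1`): the dressed site kernels of THE
massless scalar site propagator with the FULL (3.65) perturbations of §1, through part XVIII's sized socket; `hV` = part XII `v1SiteSpecies_letters`, `hF` = part XVII `v1AvgSpecies_letters`
(fit constant `K_av` read at `M_jα₀ ≤ 1`) — `d ≥ 0`, odd `L ≥ 3`, `a_S > 0`, `c₃₅ ≥ 0`, `|φ| ≤ ‖·‖`. [cite: Balaban1985BackgroundPropagators, Thm 3.2 (3.48) p.398 + Thm 3.14 pp.426–427 (quantifier template), (3.58) p.402, (3.63)–(3.67) pp.402–403 (mechanism); Balaban1984PropagatorsI, (1.45) p.26; King1986, Prop. 3.8 (3.71) p.664] -/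
theorem ne2PlusSite_v1XAS_siteF (hLodd : Odd L) (hL2 : 2 ≤ L) (hL : Odd L ∧ 1 < L) {aS : ℝ} (haS : 0 < aS) {c35 : ℝ} (hc35 : 0 ≤ c35) (hφ : ∀ a : 𝔄, |φ a| ≤ ‖a‖) (p : ℝ) :
    NE2PlusSite 4 p c35 (fun j : V1IndexSM d => fgInstanceV1GS d 𝔄 ι hL j.1)
      (sSiteExOn (fun j : V1IndexSM d => TGIndex.Mn d hL j.1.1.toTGIndex) (fun j => j.1.1.k) (fun j => j.1.1.m) (fun j => j.1.1.Msz)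
        (fun j => (Tor (fine (L ^ j.1.1.k) (TGIndex.Mn d hL j.1.1.toTGIndex)) × Fin (d + 1)) × ι) (fun j => liftBlk (blkFine L j.1.1.k (TGIndex.Mn d hL j.1.1.toTGIndex)) ι)
        (fun j => (fgInstanceV1GS d 𝔄 ι hL j.1).gf) (fun j => (fgInstanceV1GS d 𝔄 ι hL j.1).Bc) (fun j => (fgInstanceV1GS d 𝔄 ι hL j.1).Bf) aS
        (fun j => (fgInstanceV1GS d 𝔄 ι hL j.1).pair) (fun j A => v1SitePertFF d 𝔄 ι φ hL aS j.1 A) (fun j B => v1SitePertFC d 𝔄 ι φ hL aS j.1 B)) := by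
  refine ne2PlusSite_sSiteExOn_of_sizedSpeciesLettersF (L := L) (fun j : V1IndexSM d => TGIndex.Mn d hL j.1.1.toTGIndex) (fun j => j.1.1.k) (fun j => j.1.1.m) (fun j => j.1.1.Msz)
    (fun j => (Tor (fine (L ^ j.1.1.k) (TGIndex.Mn d hL j.1.1.toTGIndex)) × Fin (d + 1)) × ι) (fun j => liftBlk (blkFine L j.1.1.k (TGIndex.Mn d hL j.1.1.toTGIndex)) ι)
    (fun j => (fgInstanceV1GS d 𝔄 ι hL j.1).gf) (fun j => (fgInstanceV1GS d 𝔄 ι hL j.1).Bc) (fun j => (fgInstanceV1GS d 𝔄 ι hL j.1).Bf)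
    (fun j => v1SiteSpeciesC d 𝔄 ι φ hL j.1) (fun j => v1SiteSpeciesF d 𝔄 ι φ hL j.1)
    (fun j => v1AvgFc d 𝔄 ι φ hL j.1) (fun j => v1AvgFsc d 𝔄 ι φ hL j.1) (fun j => v1AvgFf d 𝔄 ι φ hL j.1) (fun j => v1AvgFsf d 𝔄 ι φ hL j.1)
    hLodd hL2 haS c35 4 p one_half_pos (by norm_num) (mT := fun j => j.1.1.mT)
    (fun _ _ => rfl) (fun j => j.1.1.one_le) (fun j => j.2) (fun j => j.1.1.one_le_Msz) (fun j => (fgInstanceV1GS d 𝔄 ι hL j.1).pair)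
    ⟨2 * ((d : ℝ) + 1) * ((d : ℝ) + 2) * c35, 1, by positivity, one_pos, fun j α₀ hα₀ _ A hA => v1SiteSpecies_letters d 𝔄 ι φ hL hc35 (by norm_num) hφ j.1 hα₀ A hA⟩
    ⟨((d : ℝ) + 1) * (2 * (d : ℝ) + 3) * c35, ((d : ℝ) + 1) * (2 * (d : ℝ) + 3) * c35, 1, by positivity, by positivity, one_pos, fun j α₀ hα₀ hs A hA => ?_⟩
  obtain ⟨h1, h2, h3, h4, h5, h6⟩ := v1AvgSpecies_letters (d := d) (𝔄 := 𝔄) (ι := ι) (φ := φ) hL hc35 (by norm_num : (1 : ℝ) / 2 ≤ 2) hφ j.1 hα₀ A hA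
  have hθ : 0 ≤ ((L : ℝ) ^ j.1.1.k) ^ (-((1 : ℝ) / 2 / 2)) := Real.rpow_nonneg (pow_nonneg (Nat.cast_nonneg _) _) _
  have hK : 0 ≤ ((d : ℝ) + 1) * (2 * (d : ℝ) + 3) * c35 := by positivity
  have hfit : ((d : ℝ) + 1) * (2 * (d : ℝ) + 3) * c35 * (j.1.1.Msz * α₀) * ((L : ℝ) ^ j.1.1.k) ^ (-((1 : ℝ) / 2 / 2))
      ≤ ((d : ℝ) + 1) * (2 * (d : ℝ) + 3) * c35 * ((L : ℝ) ^ j.1.1.k) ^ (-((1 : ℝ) / 2 / 2)) := by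
    have : ((d : ℝ) + 1) * (2 * (d : ℝ) + 3) * c35 * (j.1.1.Msz * α₀) ≤ ((d : ℝ) + 1) * (2 * (d : ℝ) + 3) * c35 := by nlinarith
    exact mul_le_mul_of_nonneg_right this hθ
  exact ⟨h1, h2, h3, h4, h5.mono fun y y' => diagK_mono (fun _ => hfit) y y', h6.mono fun y y' => diagK_mono (fun _ => hfit) y y'⟩

end Site

/-! ## §3 ★★★ `Live ∧ N15At` with ALL THREE layers reading the background, both site species live -/

section Knit

/-- ★★★ **`N15At` FOR THE SIZED GAUGE-DRESSED FAMILY WITH ALL THREE LAYERS READING THE BACKGROUND AND THE AVERAGING PERTURBATION LIVE** (sub-index `m ≥ 1`): OPERATOR = FILE 40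
`fgFamilyV1XAS` (S-E `n15At_v1XAS`'s first conjunct, reindexed), SITE = §2, UNIT = part XV `ne2PlusUnit_v1CovBgEx`.  `d ≥ 1`, odd `L ≥ 3`, `b, a_S, c₃₅ > 0`, `|φ| ≤ ‖·‖`. [bookkeeping] -/
theorem n15At_v1XAllF (hd : 1 ≤ d) (hLodd : Odd L) (hL2 : 2 ≤ L) (hL : Odd L ∧ 1 < L) {b aS c35 : ℝ} (hb : 0 < b) (haS : 0 < aS) (hc35 : 0 < c35)
    (hφ : ∀ a : 𝔄, |φ a| ≤ ‖a‖) (α β : Fin (d + 1)) (p : ℝ) :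
    N15At { I := V1IndexSM d, c35 := c35, p := p, pi := fun j => fgInstanceV1GS d 𝔄 ι hL j.1, Kop := fun j => fgFamilyV1XAS d 𝔄 ι e hL b j.1,
            Ksite := sSiteExOn (fun j : V1IndexSM d => TGIndex.Mn d hL j.1.1.toTGIndex) (fun j => j.1.1.k) (fun j => j.1.1.m) (fun j => j.1.1.Msz)
              (fun j => (Tor (fine (L ^ j.1.1.k) (TGIndex.Mn d hL j.1.1.toTGIndex)) × Fin (d + 1)) × ι) (fun j => liftBlk (blkFine L j.1.1.k (TGIndex.Mn d hL j.1.1.toTGIndex)) ι)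
              (fun j => (fgInstanceV1GS d 𝔄 ι hL j.1).gf) (fun j => (fgInstanceV1GS d 𝔄 ι hL j.1).Bc) (fun j => (fgInstanceV1GS d 𝔄 ι hL j.1).Bf) aS
              (fun j => (fgInstanceV1GS d 𝔄 ι hL j.1).pair) (fun j A => v1SitePertFF d 𝔄 ι φ hL aS j.1 A) (fun j B => v1SitePertFC d 𝔄 ι φ hL aS j.1 B),
            Kunit := fun j => v1CovBgEx d 𝔄 ι φ hL b α β j.1, inΛ := fun _ _ => True, unitDist := fun j => (fgInstanceV1GS d 𝔄 ι hL j.1).gc.dist } := by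
  have h := n15At_v1XAS 𝔄 ι e hd hLodd hL2 hL hb haS hc35 α β p
  exact ⟨ne2PlusOperator_reindex (fun j : V1IndexSM d => j.1) h.1, ne2PlusSite_v1XAS_siteF d 𝔄 ι φ hLodd hL2 hL haS hc35.le hφ p,
    ne2PlusUnit_v1CovBgEx d 𝔄 ι φ hd hLodd hL2 hL hb hc35 hφ α β⟩

/-- ★★★ **GUARD ∧ `N15At` — THE `Live` SIZE-LIVE FAMILY WITH ALL THREE LAYERS AND BOTH SITE SPECIES READING THE BACKGROUND** (operator: FILE 40's (3.52) species; site: part XII's first-order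
species AND part XVII's averaging species on THE massless scalar site propagator; unit: part XV's exactly dressed (2.156) kernel): `d ≥ 1`, odd `L ≥ 3`, `b, a_S, c₃₅ > 0`, `|φ| ≤ ‖·‖`. [bookkeeping] -/
theorem live_and_n15At_v1XAllF (hd : 1 ≤ d) (hLodd : Odd L) (hL2 : 2 ≤ L) (hL : Odd L ∧ 1 < L) {b aS c35 : ℝ} (hb : 0 < b) (haS : 0 < aS) (hc35 : 0 < c35)
    (hφ : ∀ a : 𝔄, |φ a| ≤ ‖a‖) (α β : Fin (d + 1)) (p : ℝ) :
    Live ⟨V1IndexSM d, c35, p, fun j => fgInstanceV1GS d 𝔄 ι hL j.1, fun j => fgFamilyV1XAS d 𝔄 ι e hL b j.1,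
        sSiteExOn (fun j : V1IndexSM d => TGIndex.Mn d hL j.1.1.toTGIndex) (fun j => j.1.1.k) (fun j => j.1.1.m) (fun j => j.1.1.Msz)
          (fun j => (Tor (fine (L ^ j.1.1.k) (TGIndex.Mn d hL j.1.1.toTGIndex)) × Fin (d + 1)) × ι) (fun j => liftBlk (blkFine L j.1.1.k (TGIndex.Mn d hL j.1.1.toTGIndex)) ι)
          (fun j => (fgInstanceV1GS d 𝔄 ι hL j.1).gf) (fun j => (fgInstanceV1GS d 𝔄 ι hL j.1).Bc) (fun j => (fgInstanceV1GS d 𝔄 ι hL j.1).Bf) aS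
          (fun j => (fgInstanceV1GS d 𝔄 ι hL j.1).pair) (fun j A => v1SitePertFF d 𝔄 ι φ hL aS j.1 A) (fun j B => v1SitePertFC d 𝔄 ι φ hL aS j.1 B),
        fun j => v1CovBgEx d 𝔄 ι φ hL b α β j.1, fun _ _ => True, fun j => (fgInstanceV1GS d 𝔄 ι hL j.1).gc.dist⟩ ∧
      N15At { I := V1IndexSM d, c35 := c35, p := p, pi := fun j => fgInstanceV1GS d 𝔄 ι hL j.1, Kop := fun j => fgFamilyV1XAS d 𝔄 ι e hL b j.1,
              Ksite := sSiteExOn (fun j : V1IndexSM d => TGIndex.Mn d hL j.1.1.toTGIndex) (fun j => j.1.1.k) (fun j => j.1.1.m) (fun j => j.1.1.Msz)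
                (fun j => (Tor (fine (L ^ j.1.1.k) (TGIndex.Mn d hL j.1.1.toTGIndex)) × Fin (d + 1)) × ι) (fun j => liftBlk (blkFine L j.1.1.k (TGIndex.Mn d hL j.1.1.toTGIndex)) ι)
                (fun j => (fgInstanceV1GS d 𝔄 ι hL j.1).gf) (fun j => (fgInstanceV1GS d 𝔄 ι hL j.1).Bc) (fun j => (fgInstanceV1GS d 𝔄 ι hL j.1).Bf) aS
                (fun j => (fgInstanceV1GS d 𝔄 ι hL j.1).pair) (fun j A => v1SitePertFF d 𝔄 ι φ hL aS j.1 A) (fun j B => v1SitePertFC d 𝔄 ι φ hL aS j.1 B),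
              Kunit := fun j => v1CovBgEx d 𝔄 ι φ hL b α β j.1, inΛ := fun _ _ => True, unitDist := fun j => (fgInstanceV1GS d 𝔄 ι hL j.1).gc.dist } :=
  ⟨live_v1XAS_site d 𝔄 ι hL hc35.le p _ _ _, n15At_v1XAllF d 𝔄 ι e φ hd hLodd hL2 hL hb haS hc35 hφ α β p⟩

end Knit

/-! ## §4 The `NE2Objects₁₁` literal of the family and its keyed faces (part XV's pattern) -/

section Record

/-- **N15's NE2 OBJECTS OF THE SIZED GAUGE-DRESSED FAMILY WITH ALL THREE LAYERS AND BOTH SITE SPECIES READING THE BACKGROUND** (RR-1's layer-A container): part XV's `v1XAllObjects` with the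
site kernel at §1's FULL (3.65) perturbations. [bookkeeping] -/
def v1XAllFObjects (hL : Odd L ∧ 1 < L) (b aS : ℝ) (α β : Fin (d + 1)) (c35 p : ℝ) : Node00.NE2Objects₁₁ where
  I := V1IndexSM d
  c35 := c35
  p := p
  pi := fun j => fgInstanceV1GS d 𝔄 ι hL j.1
  Kop := fun j => fgFamilyV1XAS d 𝔄 ι e hL b j.1
  Ksite := sSiteExOn (fun j : V1IndexSM d => TGIndex.Mn d hL j.1.1.toTGIndex) (fun j => j.1.1.k) (fun j => j.1.1.m) (fun j => j.1.1.Msz)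
    (fun j => (Tor (fine (L ^ j.1.1.k) (TGIndex.Mn d hL j.1.1.toTGIndex)) × Fin (d + 1)) × ι) (fun j => liftBlk (blkFine L j.1.1.k (TGIndex.Mn d hL j.1.1.toTGIndex)) ι)
    (fun j => (fgInstanceV1GS d 𝔄 ι hL j.1).gf) (fun j => (fgInstanceV1GS d 𝔄 ι hL j.1).Bc) (fun j => (fgInstanceV1GS d 𝔄 ι hL j.1).Bf) aS
    (fun j => (fgInstanceV1GS d 𝔄 ι hL j.1).pair) (fun j A => v1SitePertFF d 𝔄 ι φ hL aS j.1 A) (fun j B => v1SitePertFC d 𝔄 ι φ hL aS j.1 B)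
  Kunit := fun j => v1CovBgEx d 𝔄 ι φ hL b α β j.1
  inΛ := fun _ _ => True
  unitDist := fun j => (fgInstanceV1GS d 𝔄 ι hL j.1).gc.dist

variable {d}

omit [CompleteSpace 𝔄] [Nonempty ι] in
/-- The literal keeps part XV's index set, `c₃₅`, `p`, paired instances, operator and unit kernels — ONLY the site kernel changes. [bookkeeping] -/
theorem v1XAllFObjects_pi_eq (hL : Odd L ∧ 1 < L) (b aS : ℝ) (α β : Fin (d + 1)) (c35 p : ℝ) :
    (v1XAllFObjects d 𝔄 ι e φ hL b aS α β c35 p).I = (v1XAllObjects d 𝔄 ι e φ hL b aS α β c35 p).I ∧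
      HEq (v1XAllFObjects d 𝔄 ι e φ hL b aS α β c35 p).pi (v1XAllObjects d 𝔄 ι e φ hL b aS α β c35 p).pi ∧
      HEq (v1XAllFObjects d 𝔄 ι e φ hL b aS α β c35 p).Kop (v1XAllObjects d 𝔄 ι e φ hL b aS α β c35 p).Kop ∧
      HEq (v1XAllFObjects d 𝔄 ι e φ hL b aS α β c35 p).Kunit (v1XAllObjects d 𝔄 ι e φ hL b aS α β c35 p).Kunit :=
  ⟨rfl, HEq.rfl, HEq.rfl, HEq.rfl⟩

/-- ★★★ **`Live ∧ N15At` AT THE OBJECTS' BUNDLE** (`d ≥ 1`, odd `L ≥ 3`, `b, a_S, c₃₅ > 0`, `|φ| ≤ ‖·‖`). [bookkeeping] -/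
theorem live_and_n15At_v1XAllFObjects (hd : 1 ≤ d) (hLodd : Odd L) (hL2 : 2 ≤ L) (hL : Odd L ∧ 1 < L) {b aS c35 : ℝ} (hb : 0 < b) (haS : 0 < aS) (hc35 : 0 < c35)
    (hφ : ∀ a : 𝔄, |φ a| ≤ ‖a‖) (α β : Fin (d + 1)) (p : ℝ) :
    Live (ne2OfRecord₁₁ (v1XAllFObjects d 𝔄 ι e φ hL b aS α β c35 p)) ∧ N15At (ne2OfRecord₁₁ (v1XAllFObjects d 𝔄 ι e φ hL b aS α β c35 p)) :=
  live_and_n15At_v1XAllF d 𝔄 ι e φ hd hLodd hL2 hL hb haS hc35 hφ α β p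

omit [CompleteSpace 𝔄] [Nonempty ι] in
/-- RR-1's display: the objects are `Populated`. [bookkeeping] -/
theorem populated_v1XAllFObjects (hL : Odd L ∧ 1 < L) (b aS : ℝ) (α β : Fin (d + 1)) (c35 p : ℝ) : (v1XAllFObjects d 𝔄 ι e φ hL b aS α β c35 p).Populated :=
  (Node00.NE2Objects₁₁.populated_iff _).2 (v1IndexSM_nonempty d)

/-- `Live ∧ N15At` at the family-keyed literal (`d + 1 = 4`, the datum's own block factor `F.L`). [bookkeeping] -/
theorem live_and_n15At_v1XAllFObjects_family {b aS c35 : ℝ} (hb : 0 < b) (haS : 0 < aS) (hc35 : 0 < c35) (hφ : ∀ a : 𝔄, |φ a| ≤ ‖a‖) (α β : Fin 4) (p : ℝ) (F : T4Family) :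
    Live (ne2OfRecord₁₁ (haveI := neZero_blockFactor F; v1XAllFObjects 3 𝔄 ι e φ F.hL b aS α β c35 p)) ∧
      N15At (ne2OfRecord₁₁ (haveI := neZero_blockFactor F; v1XAllFObjects 3 𝔄 ι e φ F.hL b aS α β c35 p)) := by
  haveI := neZero_blockFactor F
  exact live_and_n15At_v1XAllFObjects (d := 3) 𝔄 ι e φ (by norm_num) F.hL.1 (two_le_L F) F.hL hb haS hc35 hφ α β p

variable {N : ℕ} [NeZero N] {key : (F : T4Family) → Datum F N → Prop}

/-- ★★ **THE FAMILY-KEYED READING CLOSES THE STUB AT ANY KEYED HOME** (part 30's interface; `d + 1 = 4`, the datum's own block factor): a home admitting only the literals of a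
key-indexed NE2 reading whose value everywhere IS `v1XAllFObjects 3 …` has `S_N15 RRec` — the estimate is §3, not a hypothesis. [bookkeeping] -/
theorem s_N15_of_admits_v1XAllF_family {b aS c35 : ℝ} (hb : 0 < b) (haS : 0 < aS) (hc35 : 0 < c35) (hφ : ∀ a : 𝔄, |φ a| ≤ ‖a‖) (α β : Fin 4) (p : ℝ)
    (ne2At : ∀ {F : T4Family} {D : Datum F N}, key F D → (ℕ → ℝ) → List (ULoop F) → ℕ → Node00.NE2Objects₁₁) (RRec : RateRecordPred N)
    (hadm : ∀ (F : T4Family) (D : Datum F N) (g₀ : ℕ → ℝ) (os : List (ULoop F)) (R : RateCarriers N), RRec F D g₀ os R →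
      ∃ (h : key F D) (k : ℕ), R.ne2 = ne2OfRecord₁₁ (ne2At h g₀ os k))
    (h : ∀ (F : T4Family) (D : Datum F N) (h : key F D) (g₀ : ℕ → ℝ) (os : List (ULoop F)) (k : ℕ),
      ne2At h g₀ os k = haveI := neZero_blockFactor F; v1XAllFObjects 3 𝔄 ι e φ F.hL b aS α β c35 p) :
    S_N15 RRec := by
  refine s_N15_of_admits ne2At RRec hadm fun F D hk g₀ os k => ?_
  rw [h F D hk g₀ os k]
  exact (live_and_n15At_v1XAllFObjects_family 𝔄 ι e φ hb haS hc35 hφ α β p F).2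

end Record

/-! ## §5 Positive control: the averaging species of the family is not identically zero -/

section PositiveControl

/-- THE KERNEL AT A CONSTANT COEFFICIENT, ONE STEP OFF THE BLOCK CORNER IN EVERY DIRECTION: for `a ≡ c` and the fine point `x = n·y + (1, …, 1)` (`n ≥ 2`) the staircase contour has
exactly `d + 1` bonds, so `k(x) = (d+1)·c∕n`. [folklore] -/
theorem siteAvgKer_const_bpt_one (n : ℕ) [NeZero n] (hn : 2 ≤ n) (Mn : Fin (d + 1) → ℕ) [∀ μ, NeZero (Mn μ)] (c : ℝ) (ν : Fin (d + 1)) (y : Tor Mn) :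
    siteAvgKer n Mn (fun _ _ => c) ν (bpt n Mn y fun _ => ⟨1, by omega⟩) = ((n : ℕ) : ℝ)⁻¹ * (((d : ℝ) + 1) * c) := by
  rw [siteAvgKer_apply, lineSum_bpt]
  congr 1
  unfold stairSum
  have hinner : ∀ μ : Fin (d + 1), (∑ t : Fin n, if (t : ℕ) < ((fun _ : Fin (d + 1) => (⟨1, by omega⟩ : Fin n)) μ : ℕ) then c else 0) = c := fun μ => by
    have h0 : ∀ t : Fin n, ((t : ℕ) < ((⟨1, by omega⟩ : Fin n) : ℕ)) ↔ t = ⟨0, by omega⟩ := fun t => by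
      rw [Fin.ext_iff]; simp only; constructor <;> intro h <;> omega
    simp_rw [h0]
    rw [Finset.sum_ite_eq' Finset.univ (⟨0, by omega⟩ : Fin n) (fun _ => c), if_pos (Finset.mem_univ _)]
  rw [Finset.sum_congr rfl fun μ _ => hinner μ, Finset.sum_const, Finset.card_univ, Fintype.card_fin, nsmul_eq_mul]
  push_cast; ring

/-- A block mean of a multiplier applied to the indicator of one fine point returns the multiplier's value there over the fibre size. [folklore] -/
theorem fibAvg_mulOp_single {X Y : Type} [Fintype X] [DecidableEq X] [DecidableEq Y] (q : X → Y) (k : X → ℝ) (x : X) :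
    (fibAvg q ∘ₗ mulOp k) (Pi.single x 1) (q x) = k x / (fibre q (q x)).card := by
  rw [LinearMap.comp_apply, fibAvg_apply]
  congr 1
  have hfun : mulOp k (Pi.single x (1 : ℝ)) = Pi.single x (k x) := by
    funext z
    rw [mulOp_apply]
    by_cases hz : z = x
    · subst hz; simp
    · simp [Pi.single_eq_of_ne hz]
  rw [hfun, Finset.sum_pi_single']
  rw [if_pos ((mem_fibre q (q x) x).2 rfl)]

omit [CompleteSpace 𝔄] [DecidableEq ι] [Nonempty ι] in
/-- ★ **POSITIVE CONTROL — THE AVERAGING SPECIES IS NOT IDENTICALLY ZERO**: at the CONSTANT gauge field `A′ ≡ a` (in every (3.35) window wide enough for `‖a‖`; one-step differences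
vanish) with `φ a ≠ 0`, on any index with `L^mL^k ≥ 2`, the fine averaging species `F₂′(φ∘A′)` is a NON-ZERO operator: tested on the indicator of the fine point one step off a block
corner it returns `(d+1)·φ(a)∕(L^mL^k·#fibre) ≠ 0`.  So the averaging words of parts XVIII∕XIX carry content at non-trivial backgrounds (at `A′ = 0` they vanish, as they must). [folklore] -/
theorem v1AvgFf_const_ne_zero (hL : Odd L ∧ 1 < L) (j : TGIndexS × Fin (d + 1)) (hn : 2 ≤ L ^ j.1.m * L ^ j.1.k) {a : 𝔄} (ha : φ a ≠ 0) :
    v1AvgFf d 𝔄 ι φ hL j (fun _ _ => a) ≠ 0 := by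
  classical
  set M := TGIndex.Mn d hL j.1.toTGIndex with hM
  set n' := L ^ j.1.m * L ^ j.1.k with hn'
  haveI : NeZero n' := ⟨by positivity⟩
  intro h0
  -- the test point one step off the corner of the block of `0`
  set x' : Tor (fine n' M) := bpt n' M 0 fun _ => ⟨1, by omega⟩ with hx'
  set q : Tor (fine n' M) → Tor M := blockOf (L ^ j.1.k) M ∘ underPtN L j.1.k j.1.m M with hq
  have heval : (v1AvgFf d 𝔄 ι φ hL j (fun _ _ => a)) (Pi.single x' 1) (q x') = siteAvgKer n' M (fun _ _ => φ a) j.2 x' / (fibre q (q x')).card :=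
    fibAvg_mulOp_single q (siteAvgKer n' M (fun _ _ => φ a) j.2) x'
  rw [h0, LinearMap.zero_apply, Pi.zero_apply] at heval
  have hker : siteAvgKer n' M (fun _ _ => φ a) j.2 x' = ((n' : ℕ) : ℝ)⁻¹ * (((d : ℝ) + 1) * φ a) := siteAvgKer_const_bpt_one (d := d) n' hn M (φ a) j.2 0
  have hcard : (0 : ℝ) < (fibre q (q x')).card := by exact_mod_cast Finset.card_pos.2 ⟨x', (mem_fibre q (q x') x').2 rfl⟩
  have hn0 : (0 : ℝ) < ((n' : ℕ) : ℝ) := by exact_mod_cast Nat.pos_of_ne_zero (NeZero.ne n')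
  have hne : siteAvgKer n' M (fun _ _ => φ a) j.2 x' ≠ 0 := by
    rw [hker]; exact mul_ne_zero (inv_ne_zero hn0.ne') (mul_ne_zero (by positivity) ha)
  exact hne (by
    have := heval.symm
    rwa [div_eq_zero_iff, or_iff_left hcard.ne'] at this)

end PositiveControl

end Summit.QuantumFields.YangMills.BalabanUVNodes.N15.SiteLayerBg

end
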